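/-
Copyright: the b2b-balaban cell (near-miss cell 7), T⁴-continuum fan-out; row NE7b ROUND-2 swarm, seat
t4-ne7b-formalise-leaf-05 gen 4 (row S6g′ INSTANCE of `t4/b2b-balaban-t4-ne7b-p1/LEAVES-NE7b.md`, owner's rulings
R-OWNER-23-3…-7: T3b, file 3a «CONTACT»).  Released under the licence of the surrounding project.
-/
import Summits.QuantumFields.BalabanUV.T4Continuum.Support.HistoryJoinsPlacedPhys
import Summits.QuantumFields.BalabanUV.T4Continuum.Support.HistoryJoinsClusterContact
import Summits.QuantumFields.BalabanUV.T4Continuum.Support.HistoryMemberClusterConn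

/-!
# T3b, file 3a «CONTACT»: the listing-free cluster predicate, and a REALISED member satisfies it
# (row S6g′ INSTANCE)

Summits-side support leaf of the T⁴-continuum cell (rung (B)+1 on a FINITE torus only; NOT infinite volume, NOT the
mass gap, NOT the Clay statement; NOT a proof of the spine estimate NE7b).  Row NE7b, route «COUNT», row S6g′ INSTANCE,
piece T3b.  [folklore] finite tree bookkeeping over the lineage's own carriers — leaf-09's `PGen`, leaf-10 gen 6's
node addresses `PGen.subAt`∕`naddr`, file 1's payload-tagged tree `toGenL`, leaf-07 gen 2's levelled region reading
`regZoneD … (regR …)` and its realised CONTACT `contact_of_corr`, leaf-08's `Realises`, leaf-04 gen 3's `TConn`∕`lunion`,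
leaf-02 gen 6's `tconn_append_of_bridge`, leaf-10 gen 6's `PGen.ClusterConn`; nothing is quoted from print, nothing printed is asserted, no `[cite:]` tag, no
`Prop`-valued fact minted, no definition.

WHAT.  Write `Zr t m := regZoneD Prod.fst n L K (levelOf s K) 32 (regR Prod.fst Prod.snd n L K (levelOf s K)) t (toGenL m)`
for the levelled `32`-zone at step `t` of a physical member `m : PGen (Pt d × Finset (Pt d))` (file 2's `zoneP_placed`:
it IS the count's concrete zone of the member's placement).
* THE LISTING-FREE CLUSTER PREDICATE (explicit, no definition): at every join root `q` of the flat tree `g.toGen`, the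
  zones AT THE JOIN STEP of the part SUB-MEMBERS `subAt g (q.1 ++ p.1)`, `p ∈ jparts … q.2`, are NON-EMPTY and form a
  TOUCH-CONNECTED list (`TConn («share a cell»)`) — membership-based, hence invariant under re-listing the parts
  (`tconn_of_mem_iff`); it is what leaf-02 gen 6's `physTop_of_tconn` consumes after `tconn_of_tconn_map`.
* §1 zones of members: `regZoneD_toGenL_join` (union), `lunion_clusterParts_subAt` (the zone of a member is the union
  of its step-`s` cluster parts' zones), `exists_root_pbirth`, `nonempty_regZoneD_toGenL`.
* §2 **`clusterConn_of_realises`**: a member REALISED along a run (`Realises L s R g Z`, `g.lastStep ≤ K`; run letters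
  `3 ≤ L`, `0 < n`, `s` stepwise non-increasing, drop control) satisfies the predicate — every join root's sub-member
  is realised (`realises_of_mem_crootsP`-type descent), binary contact at every same-step merge node INSIDE its cluster
  (leaf-07 gen 2's `contact_of_corr` on `(toGenL m, m)`, file 1's `corr_toGenL`) concatenates the partners' part lists
  along one bridge (`tconn_append_of_bridge`), and each part's zone contains the blocks of its root birth region.
The TRANSPORT of `ClusterConn` to the sorted twin's member (equal `pbirths` part by part, `sortTail_perm`) is file 3b.

HONEST SCOPE.  Bookkeeping over OUR carriers; `Realises` (H3's reading) is a HYPOTHESIS here, not discharged; nothing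
of H3∕(B)∕BetaPertH touched; `hdis`∕`hmult` NOT retired; NE7b NOT proved.  HONEST DEPENDENCY (cell): continuum YM on T⁴
⇐ BetaPertH ∧ nine spine estimates (0/9 proved); BetaPertH ⇐ (D1) ∧ (D4) ∧ CAP+tail; G-an2-4 gates asym, D1 and NE2/3/4.
This file changes none of it.
-/

open Finset
open Literature.MathematicalPhysics.QuantumFieldTheory.Balaban1983to89
open Literature.MathematicalPhysics.QuantumFieldTheory.Balaban1983to89.B13ScaleTransfer (Pt FaceConnected)
open Literature.MathematicalPhysics.QuantumFieldTheory.Balaban1983to89.B16SProfile (DropCtl)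
open T4PersistenceDictionary T4PartnerMultiplicity T4BranchingRecordsGas
open Summit.QuantumFields.BalabanUV.T4Continuum.PlacementSkeleton
open Summit.QuantumFields.BalabanUV.T4Continuum.ZoneTorus
open Summit.QuantumFields.BalabanUV.T4Continuum.HistoryZones
open Summit.QuantumFields.BalabanUV.T4Continuum.HistoryZoneEvolve
open Summit.QuantumFields.BalabanUV.T4Continuum.HistoryZoneMassPieces
open Summit.QuantumFields.BalabanUV.T4Continuum.HistoryAdmissible
open Summit.QuantumFields.BalabanUV.T4Continuum.HistoryRealise
open Summit.QuantumFields.BalabanUV.T4Continuum.HistoryJoins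
open Summit.QuantumFields.BalabanUV.T4Continuum.HistoryJoinsAdm
open Summit.QuantumFields.BalabanUV.T4Continuum.HistoryZoneMassJoins
open Summit.QuantumFields.BalabanUV.T4Continuum.HistoryJoinsClusterContact
open Summit.QuantumFields.BalabanUV.T4Continuum.HistoryJoinsPlacedValue

namespace Summit.QuantumFields.BalabanUV.T4Continuum.HistoryJoinsPlacedContact

noncomputable section

open scoped Classical

/-! ## §1 Zones of members -/

section Zones

variable {d : ℕ} (n L K : ℕ) (lv : ℕ → ℕ) (c : ℕ)

/-- the zone of a join is the union of the partners' zones [folklore] -/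
theorem regZoneD_toGenL_join (t : ℕ) (A B : PGen (Pt d × Finset (Pt d))) (s' : ℕ) :
    regZoneD Prod.fst n L K lv c (regR Prod.fst Prod.snd n L K lv) t (toGenL (PGen.join A B s')) =
      regZoneD Prod.fst n L K lv c (regR Prod.fst Prod.snd n L K lv) t (toGenL A) ∪
        regZoneD Prod.fst n L K lv c (regR Prod.fst Prod.snd n L K lv) t (toGenL B) :=
  regZoneD_merge _ _ _ _ _ _ _ _ _ _

/-- **THE ZONE OF A MEMBER IS THE UNION OF ITS STEP-`s` CLUSTER PARTS' ZONES** (parts as sub-members at their node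
addresses). [folklore] -/
theorem lunion_clusterParts_subAt (s t : ℕ) : ∀ m : PGen (Pt d × Finset (Pt d)),
    lunion ((clusterParts PEv.step s m.toGen).map fun p =>
        regZoneD Prod.fst n L K lv c (regR Prod.fst Prod.snd n L K lv) t (toGenL (PGen.subAt m p.1))) =
      regZoneD Prod.fst n L K lv c (regR Prod.fst Prod.snd n L K lv) t (toGenL m)
  | PGen.birth j cls x => by simp [PGen.toGen, lunion]
  | PGen.renew G h => by simp [PGen.toGen, lunion]
  | PGen.join A B s' => by
      by_cases hs : PEv.step ((s', 2, 0) : PEv) = s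
      · rw [PGen.toGen, clusterParts_merge_of_eq PEv.step hs, List.map_append, List.map_map, List.map_map,
          lunion_append, regZoneD_toGenL_join]
        have eA : ((fun p : List Bool × Gen PEv =>
              regZoneD Prod.fst n L K lv c (regR Prod.fst Prod.snd n L K lv) t (toGenL (PGen.subAt (PGen.join A B s') p.1))) ∘
            fun q : List Bool × Gen PEv => (false :: q.1, q.2)) =
            fun p => regZoneD Prod.fst n L K lv c (regR Prod.fst Prod.snd n L K lv) t (toGenL (PGen.subAt A p.1)) := by
          funext p; simp only [Function.comp_apply, PGen.subAt_join_false]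
        have eB : ((fun p : List Bool × Gen PEv =>
              regZoneD Prod.fst n L K lv c (regR Prod.fst Prod.snd n L K lv) t (toGenL (PGen.subAt (PGen.join A B s') p.1))) ∘
            fun q : List Bool × Gen PEv => (true :: q.1, q.2)) =
            fun p => regZoneD Prod.fst n L K lv c (regR Prod.fst Prod.snd n L K lv) t (toGenL (PGen.subAt B p.1)) := by
          funext p; simp only [Function.comp_apply, PGen.subAt_join_true]
        rw [eA, eB, lunion_clusterParts_subAt s t A, lunion_clusterParts_subAt s t B]
      · rw [PGen.toGen, clusterParts_merge_of_ne PEv.step hs]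
        simp [lunion]

/-- **EVERY MEMBER HAS A BIRTH AT ITS ROOT STEP.** [folklore] -/
theorem exists_root_pbirth {γ : Type*} : ∀ m : PGen γ, ∃ bz ∈ m.pbirths, bz.1.step = m.rootStep
  | PGen.birth j cls x => ⟨(((j, 0, cls) : PEv), x), by simp, rfl⟩
  | PGen.renew G h => by
      obtain ⟨bz, hbz, hs⟩ := exists_root_pbirth G
      exact ⟨bz, by simpa using hbz, hs⟩
  | PGen.join A B s' => by
      rcases le_total A.rootStep B.rootStep with h | h
      · obtain ⟨bz, hbz, hs⟩ := exists_root_pbirth A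
        exact ⟨bz, by simp [hbz], by simp [PGen.rootStep, hs, h]⟩
      · obtain ⟨bz, hbz, hs⟩ := exists_root_pbirth B
        exact ⟨bz, by simp [hbz], by simp [PGen.rootStep, hs, h]⟩

/-- **A MEMBER WITH A BIRTH OF NON-EMPTY REGION DATED `≤ t` HAS A NON-EMPTY ZONE AT `t`.** [folklore] -/
theorem nonempty_regZoneD_toGenL (hn : 0 < n) (hL : 0 < L) (hlv : LevelFn K lv) {t : ℕ}
    {m : PGen (Pt d × Finset (Pt d))} (h : ∃ bz ∈ m.pbirths, bz.1.step ≤ t ∧ bz.2.2.Nonempty) :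
    (regZoneD Prod.fst n L K lv c (regR Prod.fst Prod.snd n L K lv) t (toGenL m)).Nonempty := by
  obtain ⟨bz, hbz, hst, ⟨x, hx⟩⟩ := h
  have hb : bz ∈ births (toGenL m) := by rw [births_toGenL]; exact Multiset.mem_toFinset.2 hbz
  have hreg : (fun i => res (n * L ^ (K - lv bz.1.step)) (x i)) ∈ regR Prod.fst Prod.snd n L K lv bz :=
    mem_image_of_mem _ hx
  have hcore := blocks_subset_coreZoneD (sh := Prod.fst) (L := L) (lv := lv)
    (reg := regR Prod.fst Prod.snd n L K lv) hb hst (blockVec_mem_blocks _ hreg)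
  exact ⟨_, subset_thickT c (inRange_coreZoneD_regR (sh := Prod.fst) (pay := Prod.snd) hn hL hlv t (toGenL m)) hcore⟩

end Zones

/-! ## §2 A realised member satisfies the listing-free cluster predicate -/

section Realised

variable {d n L : ℕ} (hL : 3 ≤ L) (hn : 0 < n) {sP : ℕ → ℕ} (hs : ∀ t, sP (t + 1) ≤ sP t)
  (hdrop : ∀ m, DropCtl sP m) {R : ℕ → ℕ} {K : ℕ}
include hL hn hs hdrop

/-- **A REALISED MEMBER HAS A NON-EMPTY ZONE FROM ITS LAST STEP ON** (its root birth: anchor ∈ region, dated at the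
root step `≤ lastStep`). [folklore] -/
theorem nonempty_zone_of_realises {m : PGen (Pt d × Finset (Pt d))} {Z : Finset (Pt d)} (hR : Realises L sP R m Z)
    {t : ℕ} (ht : m.lastStep ≤ t) :
    (regZoneD Prod.fst n L K (levelOf sP K) 32 (regR Prod.fst Prod.snd n L K (levelOf sP K)) t (toGenL m)).Nonempty := by
  obtain ⟨bz, hbz, hstep⟩ := exists_root_pbirth m
  have hb : bz ∈ births (toGenL m) := by rw [births_toGenL]; exact Multiset.mem_toFinset.2 hbz
  have hfacts := births_facts_of_corr m (toGenL m) Z (corr_toGenL m) hR bz hb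
  refine nonempty_regZoneD_toGenL n L K _ 32 hn (by omega) (levelFn_levelOf (fun t _ => hs t) (hdrop K))
    ⟨bz, hbz, ?_, ⟨_, hfacts.2.1⟩⟩
  rw [hstep]
  exact (lastStep_realises_le m Z hR).trans ht

omit hL hn hs hdrop in
/-- **THE CLUSTER PARTS OF A REALISED MEMBER ARE REALISED SUB-MEMBERS, NO YOUNGER THAN THE MEMBER.** [folklore] -/
theorem realises_subAt_of_mem_clusterParts (s' : ℕ) :
    ∀ (m : PGen (Pt d × Finset (Pt d))) (Z : Finset (Pt d)), Realises L sP R m Z →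
      ∀ p ∈ clusterParts PEv.step s' m.toGen,
        ∃ Z', Realises L sP R (PGen.subAt m p.1) Z' ∧ (PGen.subAt m p.1).lastStep ≤ m.lastStep
  | PGen.birth j cls x, Z, hR, p, hp => by
      simp only [PGen.toGen, clusterParts_born, List.mem_singleton] at hp
      subst hp; exact ⟨Z, hR, le_rfl⟩
  | PGen.renew G h, Z, hR, p, hp => by
      simp only [PGen.toGen, clusterParts_renew, List.mem_singleton] at hp
      subst hp; exact ⟨Z, hR, le_rfl⟩
  | PGen.join A B s₀, Z, hR, p, hp => by
      by_cases hst : PEv.step ((s₀, 2, 0) : PEv) = s'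
      · obtain ⟨ZA, ZB, hA, hB, hAt, hBt, -, -, -, -⟩ := hR
        rw [PGen.toGen, clusterParts_merge_of_eq PEv.step hst, List.mem_append, List.mem_map, List.mem_map] at hp
        rcases hp with ⟨q, hq, rfl⟩ | ⟨q, hq, rfl⟩
        · obtain ⟨Z', hZ', hle⟩ := realises_subAt_of_mem_clusterParts s' A ZA hA q hq
          exact ⟨Z', by rw [PGen.subAt_join_false]; exact hZ', by rw [PGen.subAt_join_false]; exact hle.trans hAt⟩
        · obtain ⟨Z', hZ', hle⟩ := realises_subAt_of_mem_clusterParts s' B ZB hB q hq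
          exact ⟨Z', by rw [PGen.subAt_join_true]; exact hZ', by rw [PGen.subAt_join_true]; exact hle.trans hBt⟩
      · rw [PGen.toGen, clusterParts_merge_of_ne PEv.step hst, List.mem_singleton] at hp
        subst hp; exact ⟨Z, hR, le_rfl⟩

/-- **THE TOP CLUSTER OF A REALISED MEMBER IS TOUCH-CONNECTED**, at any cut `s′`: at a same-step join the partners'
part lists are touch-connected by induction and BRIDGED by leaf-07 gen 2's realised contact of the partners' whole
zones, each the union of its parts' zones. [folklore] -/
theorem tconn_clusterParts_of_realises :
    ∀ (m : PGen (Pt d × Finset (Pt d))) (Z : Finset (Pt d)), Realises L sP R m Z → m.lastStep ≤ K → ∀ s' : ℕ,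
      TConn (fun A B => (A ∩ B).Nonempty)
        ((clusterParts PEv.step s' m.toGen).map fun p =>
          regZoneD Prod.fst n L K (levelOf sP K) 32 (regR Prod.fst Prod.snd n L K (levelOf sP K)) s'
            (toGenL (PGen.subAt m p.1)))
  | PGen.birth j cls x, Z, _, _, s' => by
      simp only [PGen.toGen, clusterParts_born, List.map_singleton]
      exact tconn_singleton _ _
  | PGen.renew G h, Z, _, _, s' => by
      simp only [PGen.toGen, clusterParts_renew, List.map_singleton]
      exact tconn_singleton _ _
  | PGen.join A B s₀, Z, hR, hK, s' => by
      by_cases hst : PEv.step ((s₀, 2, 0) : PEv) = s'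
      · have hs₀ : s₀ = s' := hst
        have hK' : s₀ ≤ K := hK
        have hR' := hR
        obtain ⟨ZA, ZB, hA, hB, hAt, hBt, -, -, -, -⟩ := hR'
        rw [PGen.toGen, clusterParts_merge_of_eq PEv.step hst, List.map_append, List.map_map, List.map_map]
        have eA : ((fun p : List Bool × Gen PEv =>
              regZoneD Prod.fst n L K (levelOf sP K) 32 (regR Prod.fst Prod.snd n L K (levelOf sP K)) s'
                (toGenL (PGen.subAt (PGen.join A B s₀) p.1))) ∘ fun q : List Bool × Gen PEv => (false :: q.1, q.2)) =
            fun p => regZoneD Prod.fst n L K (levelOf sP K) 32 (regR Prod.fst Prod.snd n L K (levelOf sP K)) s'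
              (toGenL (PGen.subAt A p.1)) := by
          funext p; simp only [Function.comp_apply, PGen.subAt_join_false]
        have eB : ((fun p : List Bool × Gen PEv =>
              regZoneD Prod.fst n L K (levelOf sP K) 32 (regR Prod.fst Prod.snd n L K (levelOf sP K)) s'
                (toGenL (PGen.subAt (PGen.join A B s₀) p.1))) ∘ fun q : List Bool × Gen PEv => (true :: q.1, q.2)) =
            fun p => regZoneD Prod.fst n L K (levelOf sP K) 32 (regR Prod.fst Prod.snd n L K (levelOf sP K)) s'
              (toGenL (PGen.subAt B p.1)) := by
          funext p; simp only [Function.comp_apply, PGen.subAt_join_true]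
        rw [eA, eB]
        have hTA := tconn_clusterParts_of_realises A ZA hA (hAt.trans hK') s'
        have hTB := tconn_clusterParts_of_realises B ZB hB (hBt.trans hK') s'
        -- the bridge: the partners' whole zones share a cell at the join step
        obtain ⟨z, hzA, hzB⟩ := contact_of_corr hL hn hs hdrop (PGen.join A B s₀) (toGenL (PGen.join A B s₀)) Z
          (corr_toGenL _) hR hK (toGenL A) (toGenL B) ((((s₀, 2, 0) : PEv)), default) (Sub.refl _)
        have hzA' : z ∈ regZoneD Prod.fst n L K (levelOf sP K) 32 (regR Prod.fst Prod.snd n L K (levelOf sP K)) s'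
            (toGenL A) := by rw [← hs₀]; exact hzA
        have hzB' : z ∈ regZoneD Prod.fst n L K (levelOf sP K) 32 (regR Prod.fst Prod.snd n L K (levelOf sP K)) s'
            (toGenL B) := by rw [← hs₀]; exact hzB
        rw [← lunion_clusterParts_subAt n L K (levelOf sP K) 32 s' s' A, mem_lunion] at hzA'
        rw [← lunion_clusterParts_subAt n L K (levelOf sP K) 32 s' s' B, mem_lunion] at hzB'
        obtain ⟨SA, hSA, hzSA⟩ := hzA'
        obtain ⟨SB, hSB, hzSB⟩ := hzB'
        exact tconn_append_of_bridge (fun _ _ h => by rwa [inter_comm]) hTA hTB hSA hSB ⟨z, mem_inter.2 ⟨hzSA, hzSB⟩⟩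
      · rw [PGen.toGen, clusterParts_merge_of_ne PEv.step hst, List.map_singleton]
        exact tconn_singleton _ _

/-- **EVERY JOIN ROOT OF A REALISED MEMBER HAS NON-EMPTY, TOUCH-CONNECTED PART ZONES** (all join roots below any
parent step `o`). [folklore] -/
theorem clusterConn_aux_of_realises :
    ∀ (g : PGen (Pt d × Finset (Pt d))) (Z : Finset (Pt d)), Realises L sP R g Z → g.lastStep ≤ K →
      ∀ (o : Option ℕ), ∀ q ∈ crootsP PEv.step o g.toGen,
        (∀ p ∈ jparts PEv.step q.2,
            (regZoneD Prod.fst n L K (levelOf sP K) 32 (regR Prod.fst Prod.snd n L K (levelOf sP K))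
              (ftime PEv.step q.2) (toGenL (PGen.subAt g (q.1 ++ p.1)))).Nonempty) ∧
          TConn (fun A B => (A ∩ B).Nonempty)
            ((jparts PEv.step q.2).map fun p =>
              regZoneD Prod.fst n L K (levelOf sP K) 32 (regR Prod.fst Prod.snd n L K (levelOf sP K))
                (ftime PEv.step q.2) (toGenL (PGen.subAt g (q.1 ++ p.1))))
  | PGen.birth j cls x, Z, _, _, o, q, hq => by simp [PGen.toGen, crootsP] at hq
  | PGen.renew G h, Z, hR, hK, o, q, hq => by
      obtain ⟨ZG, hG, hst, -, -⟩ := hR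
      have hpos := hst.pos
      have hGK : G.lastStep ≤ K := by simp only [PGen.lastStep] at hK; omega
      have hq' : q ∈ crootsP PEv.step none G.toGen := by simpa [PGen.toGen, crootsP] using hq
      obtain ⟨X, Y, e, hXY⟩ := exists_eq_merge_of_mem_crootsP PEv.step none G.toGen q hq'
      have hsub : ∀ p ∈ jparts PEv.step q.2, PGen.subAt (PGen.renew G h) (q.1 ++ p.1) = PGen.subAt G (q.1 ++ p.1) :=
        fun p hp => PGen.subAt_renew_of_ne_nil G h (by
          rw [hXY] at hp
          have := PGen.fst_ne_nil_of_mem_jparts PEv.step hp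
          exact fun h0 => this (List.append_eq_nil_iff.1 h0).2)
      obtain ⟨ih1, ih2⟩ := clusterConn_aux_of_realises G ZG hG hGK none q hq'
      refine ⟨fun p hp => by rw [hsub p hp]; exact ih1 p hp, ?_⟩
      rw [List.map_congr_left fun p hp => by rw [hsub p hp]]
      exact ih2
  | PGen.join A B s₀, Z, hR, hK, o, q, hq => by
      have hR' := hR
      obtain ⟨ZA, ZB, hA, hB, hAt, hBt, -, -, -, -⟩ := hR'
      have hK' : s₀ ≤ K := hK
      simp only [PGen.toGen, crootsP, List.mem_append, List.mem_map] at hq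
      rcases hq with hq | ⟨q', hq', rfl⟩ | ⟨q', hq', rfl⟩
      · -- the top join root
        split_ifs at hq with ho
        · simp at hq
        · rw [List.mem_singleton] at hq
          subst hq
          simp only [List.nil_append]
          refine ⟨fun p hp => ?_, ?_⟩
          · obtain ⟨Z', hZ', hle⟩ := realises_subAt_of_mem_clusterParts _ (PGen.join A B s₀) Z hR p
              (by simpa [jparts, PGen.toGen] using hp)
            have hne := nonempty_zone_of_realises hL hn hs hdrop (K := K) hZ' hle
            simpa [ftime, PGen.toGen, PGen.lastStep] using hne
          · have h := tconn_clusterParts_of_realises hL hn hs hdrop (PGen.join A B s₀) Z hR hK s₀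
            simpa [jparts, PGen.toGen, ftime] using h
      · -- a join root below the first partner
        obtain ⟨ih1, ih2⟩ := clusterConn_aux_of_realises A ZA hA (hAt.trans hK') (some (PEv.step ((s₀, 2, 0) : PEv)))
          q' hq'
        refine ⟨fun p hp => ?_, ?_⟩
        · have := ih1 p hp
          simpa only [List.cons_append, PGen.subAt_join_false] using this
        · simpa only [List.cons_append, PGen.subAt_join_false] using ih2
      · -- a join root below the second partner
        obtain ⟨ih1, ih2⟩ := clusterConn_aux_of_realises B ZB hB (hBt.trans hK') (some (PEv.step ((s₀, 2, 0) : PEv)))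
          q' hq'
        refine ⟨fun p hp => ?_, ?_⟩
        · have := ih1 p hp
          simpa only [List.cons_append, PGen.subAt_join_true] using this
        · simpa only [List.cons_append, PGen.subAt_join_true] using ih2

/-- **A REALISED MEMBER SATISFIES THE LISTING-FREE CLUSTER PREDICATE** for the levelled `32`-zones of the run: at
every join root `q` of its flat tree the zones at the join step of the part sub-members `subAt g (q.1 ++ p.1)` are
non-empty and touch-connected. [folklore] -/
theorem clusterConn_of_realises {g : PGen (Pt d × Finset (Pt d))} {Z : Finset (Pt d)} (hR : Realises L sP R g Z)
    (hK : g.lastStep ≤ K) :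
    ∀ q ∈ croots PEv.step g.toGen,
      (∀ p ∈ jparts PEv.step q.2,
          (regZoneD Prod.fst n L K (levelOf sP K) 32 (regR Prod.fst Prod.snd n L K (levelOf sP K))
            (ftime PEv.step q.2) (toGenL (PGen.subAt g (q.1 ++ p.1)))).Nonempty) ∧
        TConn (fun A B => (A ∩ B).Nonempty)
          ((jparts PEv.step q.2).map fun p =>
            regZoneD Prod.fst n L K (levelOf sP K) 32 (regR Prod.fst Prod.snd n L K (levelOf sP K))
              (ftime PEv.step q.2) (toGenL (PGen.subAt g (q.1 ++ p.1)))) :=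
  fun q hq => clusterConn_aux_of_realises hL hn hs hdrop g Z hR hK none q hq

/-- … in leaf-10 gen 6's letters `PGen.ClusterConn` (`HistoryMemberClusterConn`, the touch-connectedness conjunct).
[folklore] -/
theorem clusterConn_of_realises' {g : PGen (Pt d × Finset (Pt d))} {Z : Finset (Pt d)} (hR : Realises L sP R g Z)
    (hK : g.lastStep ≤ K) :
    PGen.ClusterConn (fun t m =>
      regZoneD Prod.fst n L K (levelOf sP K) 32 (regR Prod.fst Prod.snd n L K (levelOf sP K)) t (toGenL m)) g :=
  fun q hq => (clusterConn_aux_of_realises hL hn hs hdrop g Z hR hK none q hq).2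

end Realised

end

end Summit.QuantumFields.BalabanUV.T4Continuum.HistoryJoinsPlacedContact
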